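import Summits.KontsevichZagierPeriods.KontsevichZagierPeriods.Theses.HurwitzMicroSectors
import Summits.KontsevichZagierPeriods.KontsevichZagierPeriods.Theorems.HurwitzMicroSectorsNormalFormPrinciplePiBoxTransfer
import Summits.KontsevichZagierPeriods.KontsevichZagierPeriods.Theorems.HurwitzMicroSectorsNormalFormPrincipleVariants2200

/-! TTRL-lite variant V2231 of stmt-KontsevichZagierPeriods-3869

Variant V2231 = `stub_boxRigidity` under the small-case move `bound_nat:m≤8` (left dimension `m ≤ 8`,
right dimension `m'` free). Verdict of the attempt seat: **open, and provably as hard as the parent** —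
this file is the certificate, not a proof of the variant. The bound is idle: the instance `m := 0 ≤ 8`
is the one-sided leaf `BoxRigidityLeft 0`, which is the whole leaf `BoxRigidity` by
`boxRigidityLeft_iff` (tree, file `…Variants2200`), so `V2231 ⟺ BoxRigidity`
(`stub_boxRigidity_var2231_iff_parent`). Hence `KontsevichZagierPeriods → V2231 → KZ.PiLocalKernel`
(`stub_boxRigidity_var2231_of_statement`, `piLocalKernel_of_stub_boxRigidity_var2231`): the variant sits
between the Summit and Ayoub's localised kernel conjecture (`@[conjecture]`, open), so it is neither
provable nor refutable from the tree; one-sided bounds `bound_nat:m≤k` / `bound_nat:m'≤k` on this stub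
never produce an easier statement (only the TWO-sided instance `m, m' ≤ 1` is a theorem,
`boxRigidity_of_le_one`). Source: M. Kontsevich, D. Zagier, *Periods* (2001), §1.2 Conjecture 1;
J. Ayoub, EMS Newsl. 91 (2014), Conj. 7. Pure proof file, no definitions. -/

-- `Summit.<Summit>.<Problem>` is the tree's mandated summit-side namespace (CONVENTIONS §2); for this
-- single-conjunct summit the two coincide, so the duplicate is deliberate.
set_option linter.dupNamespace false

noncomputable section

namespace Summit.KontsevichZagierPeriods.KontsevichZagierPeriods.Theorems

open MeasureTheory Set
open Literature.NumberTheory.Transcendental Literature.NumberTheory.Transcendental.KZ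
open Summit.KontsevichZagierPeriods.KontsevichZagierPeriods.Theses.HurwitzMicroSectors
open Summit.KontsevichZagierPeriods.HurwitzMicroSectors.NormalFormPrinciple.PiBox

/-- **V2231 ⟺ the parent leaf `BoxRigidity`**: the instance `m := 0 ≤ 8` is `BoxRigidityLeft 0`,
which is the whole leaf by `boxRigidityLeft_iff 0` (tree, `…Variants2200`; the general bounded form
`boxRigidityLeftLe_iff k` is in `…Variants2256`). [cite: KontsevichZagier2001, §1.2 Conjecture 1] -/
theorem stub_boxRigidity_var2231_iff_parent :
    (∀ (m m' : ℕ) (N : IntegralRep m) (N' : IntegralRep m'), m ≤ 8 → N.domain = {x | ∀ i, x i ∈ Set.Ioo (0:ℝ) 1} → N.IsRational → N'.domain = {x | ∀ i, x i ∈ Set.Ioo (0:ℝ) 1} → N'.IsRational → N.value = N'.value → Equivalent N N') ↔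
    (∀ (m m' : ℕ) (N : IntegralRep m) (N' : IntegralRep m'), N.domain = {x | ∀ i, x i ∈ Set.Ioo (0:ℝ) 1} → N.IsRational → N'.domain = {x | ∀ i, x i ∈ Set.Ioo (0:ℝ) 1} → N'.IsRational → N.value = N'.value → Equivalent N N') :=
  ⟨fun h => (boxRigidityLeft_iff 0).1 fun m' N N' => h 0 m' N N' (Nat.zero_le 8),
    fun h m m' N N' _ => h m m' N N'⟩

/-- **V2231 ⇒ `KZ.PiLocalKernel`** (Ayoub's localised kernel conjecture for this calculus — open): so a
proof of the variant would settle an open conjecture of the tree. [cite: Ayoub2014, Def. 6 and Conj. 7] -/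
theorem piLocalKernel_of_stub_boxRigidity_var2231
    (h : ∀ (m m' : ℕ) (N : IntegralRep m) (N' : IntegralRep m'), m ≤ 8 → N.domain = {x | ∀ i, x i ∈ Set.Ioo (0:ℝ) 1} → N.IsRational → N'.domain = {x | ∀ i, x i ∈ Set.Ioo (0:ℝ) 1} → N'.IsRational → N.value = N'.value → Equivalent N N') :
    PiLocalKernel :=
  piLocalKernel_of_boxRigidity (stub_boxRigidity_var2231_iff_parent.1 h)

/-- **`KontsevichZagierPeriods ⇒ V2231`**: the variant is a special case of Conjecture 1 for the
tree's calculus — so a refutation of the variant would refute the Summit. [cite: KontsevichZagier2001, §1.2 Conjecture 1] -/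
theorem stub_boxRigidity_var2231_of_statement (h : _root_.KontsevichZagierPeriods) :
    ∀ (m m' : ℕ) (N : IntegralRep m) (N' : IntegralRep m'), m ≤ 8 → N.domain = {x | ∀ i, x i ∈ Set.Ioo (0:ℝ) 1} → N.IsRational → N'.domain = {x | ∀ i, x i ∈ Set.Ioo (0:ℝ) 1} → N'.IsRational → N.value = N'.value → Equivalent N N' :=
  fun m m' N N' _ => (leaves_of_statement h).1 m m' N N'

/-- **Summit ⟺ V2231 ∧ PiCancellation** (from `statement_iff_leaves`): with `π`-cancellation the variant
is exactly what the Summit needs, no more and no less. [cite: KontsevichZagier2001, §1.2 Conjecture 1] -/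
theorem statement_iff_stub_boxRigidity_var2231_and_piCancellation :
    _root_.KontsevichZagierPeriods ↔
    ((∀ (m m' : ℕ) (N : IntegralRep m) (N' : IntegralRep m'), m ≤ 8 → N.domain = {x | ∀ i, x i ∈ Set.Ioo (0:ℝ) 1} → N.IsRational → N'.domain = {x | ∀ i, x i ∈ Set.Ioo (0:ℝ) 1} → N'.IsRational → N.value = N'.value → Equivalent N N') ∧
      PiCancellation) := by
  rw [statement_iff_leaves, stub_boxRigidity_var2231_iff_parent]

end Summit.KontsevichZagierPeriods.KontsevichZagierPeriods.Theorems
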